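import Summits.BirchSwinnertonDyer.Rank1Residual.Additive.GordRankOneKatoCertificateBSD
import HarnessLib

/-!
# The (G)-cell at analytic rank ONE, defect 2 — the WEAK certificate: a SIMPLE analytic zero
# (`[T¹](ϖ·B_{(p−1)/2}) ≠ 0`) already DISCHARGES Schneider's rider via Kato / Wuthrich + Delbourgo
# 2002 (B), and gives the Kato-type UPPER bound `ord_p #Ш + ord_p Reg_p + ord_p ∏c + ord_p ℓ ≤
# ord_p [T¹](ϖ·B) + 1 + 2 ord_p #tors` (cell `b2b-bsdres`, sub-cell additive-p2, gen 19; sequel of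
# `GordRankOneKatoCertificate{,Class,BSD}`)

HONEST FRAMING (cell `b2b-bsdres`, run/shared/lean/b2b/bsd-rank1-residual/, verbatim in every
file): the goal of the cell is to DELETE the COMBINATION-SHAPED residual classes of the
Birch–Swinnerton-Dyer formula for ALL analytic-rank `≤ 1` elliptic curves over `ℚ` — "full BSD
formula for every rank `≤ 1` curve in class `C`" assembled STRICTLY from published theorems — so
that the rank-`≤ 1` remainder becomes exactly the CONSTRUCTION-SHAPED classes, which are TYPED
(missing-input `Prop`s), NOT attempted. This is not "finishing BSD". Sub-cell `additive-p2`
(CLASS-OWNERS row "X3/X4 additive — pot. good ordinary / X3♯(G-ord)"), generation 19: research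
route; no claim beyond the stated classes; X3♯(G-ord)/X4♯(G-ord) stay CONSTRUCTION-SHAPED; labels /
census / located gap UNCHANGED; nothing is booked. ONE definition (a CERTIFICATE-SHAPED typed input,
nothing asserted) and theorems; named facts enter as HYPOTHESES only (the semistable half-eigenspace
readings of Kato 2004 Thm. 17.4 (3) / Wuthrich 2014 Thm. 16, Delbourgo 2002 (A)+(B) = A175, GZK,
modularity). No `_holds`, no new named fact (debt 0).

## What and why

`GordRankOneKatoCertificate*.lean` used the STRONG (unit) certificate `‖[T¹](ϖ·B)‖_p = 1` (`μ = 0`,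
`λ = 1`, EXACT identity). The weaker finding "the branch has a zero of order EXACTLY one" (`A′ ≠ 0`,
700/700 rows, ttrl2 X4-1 §6 / X4-2 §2) already gives HALF of it: Kato / Wuthrich + [C] give
`ι g = C(u·ϖ)·B` for some `g ∈ char_Λ X(E/ℚ_∞)`; for a generator `fE` (`g = fE·h`, `fE(0) = 0` by (B)
clause 1 at rank one) `[T¹] g = [T¹] fE · h(0)`, so `[T¹](ϖ·B) ≠ 0 ⟹ ord_T fE = 1 = rank ⟹` (clause 2)
**Schneider's `Reg_p(E,Dh) ≠ 0`, `#Ш[p^∞] < ∞`**, and (clause 3, `ord_p h(0) ≥ 0`) **`ord_p #Ш(E) +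
ord_p Reg_p(E,Dh) + ord_p ∏c_ℓ + ord_p ℓ ≤ ord_p [T¹](ϖ·B) + 1 + 2·ord_p #E(ℚ)_tors`** — the additive
counterpart of the Kato–Perrin-Riou–Schneider bound behind Stein–Wuthrich's `Ш`-bound algorithm,
with EQUALITY iff `h(0) ∈ ℤ_p^×` (the Main-Conjecture cofactor at this pair).

§0 `BranchCoeffOneNeZeroAt W p` (typed, nothing asserted: "the analytic branch has a SIMPLE zero");
§1 `Λ`-algebra; §2 cell-agnostic core `schneider_and_padicVal_le_rankOne_of_iota_eq`; §3 class forms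
`ClassX4Gord.schneider_and_padicVal_le_rankOne_of_katoHalf` (X4♯(G-ord) ∩ I₀* ∩ {ρ̄ onto}, `p ≥ 5`) /
`ClassX3Gord.…_of_wuthrichHalf` for EVERY (B)-datum — gen 18's conjunct 2 (Schneider certificate) is
DISCHARGED wherever the branch has a simple zero, and `RankOneIwasawaInputAt W p ↔ BSDp W p` on the
non-anomalous such rows.
CENSUS READING (EVIDENCE only; X42-REPORT e8592c9a…): with `h = unit·Reg_p(Dh)`, `ord A′ = ord [T¹](ϖB) + 1`
and the table's `v(A′) = v(h) + v(C)` (700/700) the bound reads `ord_p #Ш + ord_p ℓ ≤ ord_p #Ш_an`: the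
UPPER HALF of `BSD(E,p)` on every defect-2 rank-1 row in scope, unit certificate or not. Nothing booked.

References: [Kato2004Asterisque] Thm. 17.4 (3); [Wuthrich2014] Thm. 16; [Delbourgo2002] Thm. (A), (B);
[Schneider1985]; [PerrinRiou1987]; [SteinWuthrich2013] §4; [Miller2011LMS] Def. 1.1.
-/

noncomputable section

open scoped Classical MatrixGroups ModularForm NumberField

namespace Summit.BirchSwinnertonDyer.Rank1Residual.Additive

open CongruenceSubgroup WeierstrassCurve NumberField Literature.NumberTheory.EllipticCurves
  Literature.NumberTheory.EllipticCurves.ModularForms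
  Literature.NumberTheory.EllipticCurves.Rank1Residual
  Literature.NumberTheory.EllipticCurves.Rank1Residual.Typed
  Literature.NumberTheory.EllipticCurves.Delbourgo2002
  Literature.NumberTheory.GaloisRepresentations Summit.BirchSwinnertonDyer.Rank1Residual.AdditivePotMult
  Summit.BirchSwinnertonDyer.Rank1Residual.X1.MuLambda
  Summit.BirchSwinnertonDyer.Rank1Residual.X1.RankOneParitySqueeze
  IsDedekindDomain

/-! ### §0 The WEAK certificate: the branch has a SIMPLE zero (typed; nothing asserted) -/

/-- **TYPED INPUT (certificate-shaped; nothing asserted): `[T¹](ϖ·B_{(p−1)/2}) ≠ 0`.** For every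
globally minimal `V` with `C • V^{(p*)} = W`, ordinary at `p`, every newform `f` of `V` and every
period ratio `ϖ` of the parity of `(p−1)/2`, the linear coefficient of the Néron-normalised MTT
branch `ϖ·B_{(p−1)/2}(f, α_p(V))` is NON-ZERO — "the twisted `p`-adic `L`-series has a zero of order
EXACTLY one" when `L(E,1) = 0` (census: `A′ ≠ 0`). A predicate on `(W, p)`.
[cite: MazurTateTeitelbaum1986Invent, §I.13–I.14 (the branch series; nothing asserted)] -/
def BranchCoeffOneNeZeroAt (W : WeierstrassCurve ℚ) (p : ℕ) [Fact p.Prime] : Prop :=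
  ∀ (V : WeierstrassCurve ℚ) [V.IsElliptic] [V.IsGloballyMinimal] (C : VariableChange ℚ),
    C • V.quadraticTwist ((-1 : ℚ) ^ (p / 2) * p) = W → IsOrdinaryAt V p →
    ∀ {N : ℕ} [NeZero N] (f : CuspForm (Gamma0 N) 2), IsNewformOf V f →
    ∀ ϖ : ℚ, (if Even (p / 2) then (ϖ : ℝ) * V.realPeriodRat = plusPeriod f
        else (ϖ : ℝ) * V.imaginaryPeriodRat = minusPeriod f) →
      PowerSeries.coeff 1 (PowerSeries.C (ϖ : ℚ_[p]) *
          (if Even (p / 2) then padicLFunctionBranch f ((unitRoot V p : ℤ_[p]) : ℚ_[p]) (p / 2)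
            else padicLFunctionMinusBranch f ((unitRoot V p : ℤ_[p]) : ℚ_[p]) (p / 2))) ≠ 0

/-- The unit certificate implies the weak one (`‖x‖ = 1 ⟹ x ≠ 0`). [folklore] -/
theorem branchCoeffOneNeZeroAt_of_branchUnitCertificateAt {W : WeierstrassCurve ℚ} {p : ℕ}
    [Fact p.Prime] (h : BranchUnitCertificateAt W p) : BranchCoeffOneNeZeroAt W p := by
  intro V _ _ C hC hord N _ f hf ϖ hϖ h0
  have h1 := (h V C hC hord f hf ϖ hϖ).2
  rw [h0, norm_zero] at h1
  exact zero_ne_one h1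

variable {W : WeierstrassCurve ℚ} {p : ℕ} [hp : Fact p.Prime]

/-! ### §1 `Λ`-algebra -/

omit hp in
/-- `[T¹](fE·h) = [T¹] fE · h(0)` when `fE(0) = 0`. [folklore] -/
theorem coeff_one_mul_eq_mul_constantCoeff [Fact p.Prime] {fE h : IwasawaAlgebra p}
    (h0 : PowerSeries.constantCoeff fE = 0) :
    PowerSeries.coeff 1 (fE * h) = PowerSeries.coeff 1 fE * PowerSeries.constantCoeff h := by
  rw [PowerSeries.coeff_mul, Finset.Nat.antidiagonal_succ, Finset.sum_cons,
    Finset.Nat.antidiagonal_zero]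
  simp [h0]

omit hp in
/-- From `ι g = C(u·ϖ)·B`: `[T¹] g = u · [T¹](ϖ·B)` in `ℚ_p`. [folklore] -/
theorem coe_coeff_one_eq_of_iota_eq [Fact p.Prime] {g : IwasawaAlgebra p} {u : ℤ_[p]ˣ} {ϖ : ℚ}
    {B : PowerSeries ℚ_[p]}
    (hι : iwasawaToPowerSeries p g =
      PowerSeries.C (((u : ℤ_[p]) : ℚ_[p]) * (ϖ : ℚ_[p])) * B) :
    ((PowerSeries.coeff 1 g : ℤ_[p]) : ℚ_[p]) =
      ((u : ℤ_[p]) : ℚ_[p]) * PowerSeries.coeff 1 (PowerSeries.C (ϖ : ℚ_[p]) * B) := by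
  rw [← Wuthrich2014.coeff_iwasawaToPowerSeries p g 1, hι, PowerSeries.coeff_C_mul,
    PowerSeries.coeff_C_mul, mul_assoc]

/-! ### §2 Cell-agnostic core: a simple analytic zero ⟹ Schneider + the upper bound -/

/-- **Core.** Let `p ≠ 2`, `rank_ℤ E(ℚ) = 1`, `Dh` a (B)-datum (`hB`), `D` a cyclotomic dual datum with
`X` torsion and generator `fE`, and `g ∈ char_Λ X` with `ι g = C(u·ϖ)·B`, `[T¹](ϖ·B) ≠ 0`. Then
`Reg_p(E,Dh) ≠ 0` (Schneider), `Ш(E/ℚ)[p^∞]` is finite, and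
`ord_p #Ш[p^∞] + ord_p Reg_p(E,Dh) + ord_p ∏c_ℓ + ord_p ℓ ≤ ord_p [T¹](ϖ·B) + 1 + 2·ord_p #E(ℚ)_tors`
with `ℓ ∣ p²`, `ℓ = 1` off the anomalous rows. [cite: Delbourgo2002, Theorem (B) (p. 40)]
[cite: SteinWuthrich2013, §4 (the good ordinary shape)] -/
theorem schneider_and_padicVal_le_rankOne_of_iota_eq [W.IsElliptic] (hp2 : p ≠ 2) (hr1 : W.mordellWeilRank = 1)
    {Dh : PAdicHeightData W p} (hB : LeadingTermClauses W p Dh)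
    {κ : ZpExtension ℚ p} {γ : Field.absoluteGaloisGroup ℚ}
    (hκ : κ.IsCyclotomic) (hγ : κ.IsTopGenerator γ) (hγ' : IsCyclotomicVariable p γ)
    (D : W.SelmerDualData κ γ) [Module.Finite (IwasawaAlgebra p) D.X] (hX : D.IsTorsion)
    {fE g : IwasawaAlgebra p} (hchar : D.charIdeal = Ideal.span {fE}) (hg : g ∈ D.charIdeal)
    {u : ℤ_[p]ˣ} {ϖ : ℚ} {B : PowerSeries ℚ_[p]}
    (hι : iwasawaToPowerSeries p g =
      PowerSeries.C (((u : ℤ_[p]) : ℚ_[p]) * (ϖ : ℚ_[p])) * B)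
    (hne : PowerSeries.coeff 1 (PowerSeries.C (ϖ : ℚ_[p]) * B) ≠ 0) :
    SchneiderConjecture Dh ∧ Finite (AddCommGroup.primaryComponent W.sha p) ∧
      ∃ ℓ : ℕ, ℓ ∣ p ^ 2 ∧ (ReductionNonAnomalous W p → ℓ = 1) ∧
        (padicValNat p (Nat.card (AddCommGroup.primaryComponent W.sha p)) : ℤ) +
            (padicRegulator Dh).valuation + padicValNat p W.tamagawaProduct + padicValNat p ℓ ≤
          (PowerSeries.coeff 1 (PowerSeries.C (ϖ : ℚ_[p]) * B)).valuation + 1 +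
            2 * padicValNat p W.torsionOrder := by
  have hpP : p.Prime := hp.out
  -- `g = fE · h`, `fE(0) = 0`
  have hgmem : g ∈ Ideal.span {fE} := by rw [← hchar]; exact hg
  obtain ⟨h, hgh⟩ := Ideal.mem_span_singleton'.mp hgmem
  have hle : (W.mordellWeilRank : ℕ∞) ≤ fE.order := (hB κ γ hκ hγ hγ' D hX fE hchar).1
  have hf0 : PowerSeries.constantCoeff fE = 0 := by
    rw [← PowerSeries.coeff_zero_eq_constantCoeff]
    apply PowerSeries.coeff_of_lt_order
    refine lt_of_lt_of_le ?_ hle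
    rw [hr1]
    exact_mod_cast Nat.zero_lt_one
  have hg1 : PowerSeries.coeff 1 g = PowerSeries.coeff 1 fE * PowerSeries.constantCoeff h := by
    rw [← hgh, mul_comm h fE]
    exact coeff_one_mul_eq_mul_constantCoeff hf0
  -- `[T¹] g ≠ 0`, hence `[T¹] fE ≠ 0` and `h(0) ≠ 0`
  have hcoe := coe_coeff_one_eq_of_iota_eq hι
  have hu0 : ((u : ℤ_[p]) : ℚ_[p]) ≠ 0 := coe_units_ne_zero p u
  have hg1Q : ((PowerSeries.coeff 1 g : ℤ_[p]) : ℚ_[p]) ≠ 0 := by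
    rw [hcoe]; exact mul_ne_zero hu0 hne
  have hg1ne : PowerSeries.coeff 1 g ≠ 0 := fun h0 ↦ hg1Q (by rw [h0]; rfl)
  have hfE1 : PowerSeries.coeff 1 fE ≠ 0 := fun h0 ↦ hg1ne (by rw [hg1, h0, zero_mul])
  have hh0 : PowerSeries.constantCoeff h ≠ 0 := fun h0 ↦ hg1ne (by rw [hg1, h0, mul_zero])
  -- `ord_T fE = 1 = rank` ⟹ Schneider and finiteness
  have hord : fE.order = W.mordellWeilRank := by
    refine le_antisymm ?_ hle
    rw [hr1]
    exact_mod_cast PowerSeries.order_le 1 hfE1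
  obtain ⟨hS, hfin⟩ := (hB κ γ hκ hγ hγ' D hX fE hchar).2.1.mp hord
  obtain ⟨u', ℓ, hℓp, hℓ1, heq⟩ := (hB κ γ hκ hγ hγ' D hX fE hchar).2.2 hS hfin
  rw [hr1, pow_one] at heq
  refine ⟨hS, hfin, ℓ, hℓp, hℓ1, ?_⟩
  -- valuations
  obtain ⟨w, hw⟩ := exists_unit_padicLog_cyclotomicGenerator (p := p) hp2
  have hpQ : (p : ℚ_[p]) ≠ 0 := by exact_mod_cast hpP.ne_zero
  have hlog0 : padicLog p (cyclotomicGenerator p : ℚ_[p]) ≠ 0 := by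
    rw [hw]; exact mul_ne_zero hpQ (coe_units_ne_zero p w)
  have hlogv : (padicLog p (cyclotomicGenerator p : ℚ_[p])).valuation = 1 := by
    rw [hw, Padic.valuation_mul hpQ (coe_units_ne_zero p w), Padic.valuation_p,
      valuation_coe_units_eq_zero, add_zero]
  have hT0 : W.torsionOrder ≠ 0 := (W.torsionOrder_pos_holds).ne'
  have hTQ : (W.torsionOrder : ℚ_[p]) ≠ 0 := by exact_mod_cast hT0
  have hu'0 : ((u' : ℤ_[p]) : ℚ_[p]) ≠ 0 := coe_units_ne_zero p u'
  have hℓ0 : ℓ ≠ 0 := by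
    rintro rfl
    exact hpP.ne_zero (pow_eq_zero_iff (n := 2) (by norm_num) |>.mp (zero_dvd_iff.mp hℓp))
  have hℓQ : (ℓ : ℚ_[p]) ≠ 0 := by exact_mod_cast hℓ0
  haveI : Finite (AddCommGroup.primaryComponent W.sha p) := hfin
  have hShp0 : (Nat.card (AddCommGroup.primaryComponent W.sha p) : ℚ_[p]) ≠ 0 := by
    exact_mod_cast Nat.card_pos.ne'
  have hRg0 : padicRegulator Dh ≠ 0 := hS
  have hCc0 : (W.tamagawaProduct : ℚ_[p]) ≠ 0 := by
    exact_mod_cast (W.tamagawaProduct_pos_holds : 0 < W.tamagawaProduct).ne'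
  have hfE1Q : ((PowerSeries.coeff 1 fE : ℤ_[p]) : ℚ_[p]) ≠ 0 := fun h0 ↦
    hfE1 (PadicInt.coe_eq_zero.mp h0)
  have hh0Q : ((PowerSeries.constantCoeff h : ℤ_[p]) : ℚ_[p]) ≠ 0 := fun h0 ↦
    hh0 (PadicInt.coe_eq_zero.mp h0)
  -- left side of clause 3
  have hL : (((PowerSeries.coeff 1 fE : ℤ_[p]) : ℚ_[p]) *
        padicLog p (cyclotomicGenerator p) * (W.torsionOrder : ℚ_[p]) ^ 2).valuation =
      ((PowerSeries.coeff 1 fE : ℤ_[p]) : ℚ_[p]).valuation + 1 +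
        2 * (padicValNat p W.torsionOrder : ℤ) := by
    rw [Padic.valuation_mul (mul_ne_zero hfE1Q hlog0) (pow_ne_zero 2 hTQ),
      Padic.valuation_mul hfE1Q hlog0, Padic.valuation_pow, hlogv, Padic.valuation_natCast]
    push_cast
    ring
  have hR : (((u' : ℤ_[p]) : ℚ_[p]) * (ℓ : ℚ_[p]) *
        ((Nat.card (AddCommGroup.primaryComponent W.sha p) : ℚ_[p]) * padicRegulator Dh *
          (W.tamagawaProduct : ℚ_[p]))).valuation =
      (padicValNat p ℓ : ℤ) +
        ((padicValNat p (Nat.card (AddCommGroup.primaryComponent W.sha p)) : ℤ) +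
          (padicRegulator Dh).valuation + padicValNat p W.tamagawaProduct) := by
    rw [Padic.valuation_mul (mul_ne_zero hu'0 hℓQ) (mul_ne_zero (mul_ne_zero hShp0 hRg0) hCc0),
      Padic.valuation_mul hu'0 hℓQ, valuation_coe_units_eq_zero, zero_add, Padic.valuation_natCast,
      Padic.valuation_mul (mul_ne_zero hShp0 hRg0) hCc0, Padic.valuation_mul hShp0 hRg0,
      Padic.valuation_natCast, Padic.valuation_natCast]
  have hval := congrArg Padic.valuation heq
  rw [hL, hR] at hval
  -- `ord [T¹] fE ≤ ord [T¹] g = ord [T¹](ϖ·B)`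
  have hle1 : ((PowerSeries.coeff 1 fE : ℤ_[p]) : ℚ_[p]).valuation ≤
      (PowerSeries.coeff 1 (PowerSeries.C (ϖ : ℚ_[p]) * B)).valuation := by
    have hgv : ((PowerSeries.coeff 1 g : ℤ_[p]) : ℚ_[p]).valuation =
        (PowerSeries.coeff 1 (PowerSeries.C (ϖ : ℚ_[p]) * B)).valuation := by
      rw [hcoe, Padic.valuation_mul hu0 hne, valuation_coe_units_eq_zero, zero_add]
    rw [← hgv, hg1, PadicInt.coe_mul, Padic.valuation_mul hfE1Q hh0Q]
    have := PadicInt.valuation_coe_nonneg (x := PowerSeries.constantCoeff h)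
    linarith
  linarith

/-! ### §3 Class forms on defect 2 -/

variable [W.IsElliptic]

/-- **X4♯(G-ord) ∩ `I₀*` ∩ {`ρ̄` onto}, `p ≥ 5`, `r_an = 1`: a SIMPLE analytic zero of the twisted
branch DISCHARGES Schneider and bounds `Ш` from ABOVE** — for the good-ordinary twist model `V`, its
newform `f`, a period ratio `ϖ` with `[T¹](ϖ·B_{(p−1)/2}) ≠ 0`, and EVERY (B)-datum `Dh`:
`Reg_p(E,Dh) ≠ 0` and `ord_p #Ш(E) + ord_p Reg_p(E,Dh) + ord_p ∏c_ℓ + ord_p ℓ ≤ ord_p [T¹](ϖ·B) + 1 +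
2·ord_p #E(ℚ)_tors` (`ℓ ∣ p²`, `= 1` off the anomalous rows). [cite: Kato2004Asterisque, Thm. 17.4 (3) (p. 273)]
[cite: Delbourgo2002, Theorem (B) (p. 40)] [cite: SteinWuthrich2013, §4] -/
theorem ClassX4Gord.schneider_and_padicVal_le_rankOne_of_katoHalf
    (hK : Wuthrich2014.kato_halfEigenCharIdeal_dvd_cyclotomicPrime_of_surjective)
    (hGZK : rank_eq_analyticRank_of_analyticRank_le_one)
    (hX : ClassX4Gord W p) (hp5 : 5 ≤ p) (hsurj : Surj W p) (hr : W.analyticRank = 1)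
    (V : WeierstrassCurve ℚ) [V.IsElliptic] [V.IsGloballyMinimal] (C : VariableChange ℚ)
    (hC : C • V.quadraticTwist ((-1 : ℚ) ^ (p / 2) * p) = W) (hV : GoodOrd V p)
    {N : ℕ} [NeZero N] {f : CuspForm (Gamma0 N) 2} (hf : IsNewformOf V f) (ϖ : ℚ)
    (hϖ : if Even (p / 2) then (ϖ : ℝ) * V.realPeriodRat = plusPeriod f
      else (ϖ : ℝ) * V.imaginaryPeriodRat = minusPeriod f)
    (hne : PowerSeries.coeff 1 (PowerSeries.C (ϖ : ℚ_[p]) *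
      (if Even (p / 2) then padicLFunctionBranch f ((unitRoot V p : ℤ_[p]) : ℚ_[p]) (p / 2)
        else padicLFunctionMinusBranch f ((unitRoot V p : ℤ_[p]) : ℚ_[p]) (p / 2))) ≠ 0)
    {Dh : PAdicHeightData W p} (hB : LeadingTermClauses W p Dh) :
    SchneiderConjecture Dh ∧
      ∃ ℓ : ℕ, ℓ ∣ p ^ 2 ∧ (ReductionNonAnomalous W p → ℓ = 1) ∧
        (padicValNat p W.shaOrder : ℤ) + (padicRegulator Dh).valuation +
            padicValNat p W.tamagawaProduct + padicValNat p ℓ ≤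
          (PowerSeries.coeff 1 (PowerSeries.C (ϖ : ℚ_[p]) *
              (if Even (p / 2) then padicLFunctionBranch f ((unitRoot V p : ℤ_[p]) : ℚ_[p]) (p / 2)
                else padicLFunctionMinusBranch f ((unitRoot V p : ℤ_[p]) : ℚ_[p]) (p / 2)))).valuation +
            1 + 2 * padicValNat p W.torsionOrder := by
  have hp2 : p ≠ 2 := by omega
  obtain ⟨hmw, hfinSha⟩ := hGZK W (by rw [hr])
  have hr1 : W.mordellWeilRank = 1 := by rw [hmw, hr]
  haveI : Finite W.sha := hfinSha
  obtain ⟨κ, γ, hκ, hγ, hγ', D, fE, hchar⟩ := exists_cyclotomic_dualData_generator W p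
  haveI : Module.Finite (IwasawaAlgebra p) D.X :=
    SelmerDualData.module_finite_of_isCyclotomic (W := W) (κ := κ) hκ D hγ
  have hj := padicValRat_j_nonneg_of_typeGOrd W p hX.typeGOrd
  have hsurjV : ∀ n : ℕ, V.HasSurjectiveModNGaloisRep (p ^ n : ℕ) :=
    X4RankZeroTwistOdd.forall_surj_pow_twist_of_surj W p hp5 V (pStar_ne_zero p) C hC hsurj
  obtain ⟨hXt, g, hg, u, hι⟩ := isTorsion_and_exists_iota_eq_branch_of_katoComponent W p
    (Kato2004.charIdeal_dvd_padicLFunctionBranch_component_of_surjective_of_half hK) hj hp2 V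
    ⟨C, hC⟩ (Or.inl hV) hsurjV hκ hγ hγ' hf D ϖ hϖ
  obtain ⟨hS, -, ℓ, hℓp, hℓ1, hle⟩ := schneider_and_padicVal_le_rankOne_of_iota_eq hp2 hr1 hB hκ hγ
    hγ' D hXt hchar hg hι hne
  refine ⟨hS, ℓ, hℓp, hℓ1, ?_⟩
  rw [padicValNat_card_addPrimaryComponent] at hle
  exact hle

/-- **X3♯(G-ord) ∩ `I₀*`, `p ≥ 3`, `r_an = 1`: the same from Wuthrich's reducible component reading.**
[cite: Wuthrich2014, Thm. 16 (p. 397)] [cite: Delbourgo2002, Theorem (B) (p. 40)] -/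
theorem ClassX3Gord.schneider_and_padicVal_le_rankOne_of_wuthrichHalf
    (hWu : Wuthrich2014.thm16_halfEigenCharIdeal_dvd_cyclotomicPrime)
    (hGZK : rank_eq_analyticRank_of_analyticRank_le_one)
    (hX : ClassX3Gord W p) (hp2 : p ≠ 2) (hr : W.analyticRank = 1)
    (V : WeierstrassCurve ℚ) [V.IsElliptic] [V.IsGloballyMinimal] (C : VariableChange ℚ)
    (hC : C • V.quadraticTwist ((-1 : ℚ) ^ (p / 2) * p) = W) (hV : GoodOrd V p)
    {N : ℕ} [NeZero N] {f : CuspForm (Gamma0 N) 2} (hf : IsNewformOf V f) (ϖ : ℚ)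
    (hϖ : if Even (p / 2) then (ϖ : ℝ) * V.realPeriodRat = plusPeriod f
      else (ϖ : ℝ) * V.imaginaryPeriodRat = minusPeriod f)
    (hne : PowerSeries.coeff 1 (PowerSeries.C (ϖ : ℚ_[p]) *
      (if Even (p / 2) then padicLFunctionBranch f ((unitRoot V p : ℤ_[p]) : ℚ_[p]) (p / 2)
        else padicLFunctionMinusBranch f ((unitRoot V p : ℤ_[p]) : ℚ_[p]) (p / 2))) ≠ 0)
    {Dh : PAdicHeightData W p} (hB : LeadingTermClauses W p Dh) :
    SchneiderConjecture Dh ∧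
      ∃ ℓ : ℕ, ℓ ∣ p ^ 2 ∧ (ReductionNonAnomalous W p → ℓ = 1) ∧
        (padicValNat p W.shaOrder : ℤ) + (padicRegulator Dh).valuation +
            padicValNat p W.tamagawaProduct + padicValNat p ℓ ≤
          (PowerSeries.coeff 1 (PowerSeries.C (ϖ : ℚ_[p]) *
              (if Even (p / 2) then padicLFunctionBranch f ((unitRoot V p : ℤ_[p]) : ℚ_[p]) (p / 2)
                else padicLFunctionMinusBranch f ((unitRoot V p : ℤ_[p]) : ℚ_[p]) (p / 2)))).valuation +
            1 + 2 * padicValNat p W.torsionOrder := by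
  obtain ⟨hmw, hfinSha⟩ := hGZK W (by rw [hr])
  have hr1 : W.mordellWeilRank = 1 := by rw [hmw, hr]
  haveI : Finite W.sha := hfinSha
  obtain ⟨κ, γ, hκ, hγ, hγ', D, fE, hchar⟩ := exists_cyclotomic_dualData_generator W p
  haveI : Module.Finite (IwasawaAlgebra p) D.X :=
    SelmerDualData.module_finite_of_isCyclotomic (W := W) (κ := κ) hκ D hγ
  have hj := padicValRat_j_nonneg_of_typeGOrd W p hX.typeGOrd
  obtain ⟨hXt, g, hg, u, hι⟩ := isTorsion_and_exists_iota_eq_branch_of_wuthrichComponent W p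
    (Wuthrich2014.charIdeal_dvd_padicLFunctionBranch_component_of_half hWu) hj hp2 V
    ⟨C, hC⟩ (Or.inl hV) hX.classX3.1 hκ hγ hγ' hf D ϖ hϖ
  obtain ⟨hS, -, ℓ, hℓp, hℓ1, hle⟩ := schneider_and_padicVal_le_rankOne_of_iota_eq hp2 hr1 hB hκ hγ
    hγ' D hXt hchar hg hι hne
  refine ⟨hS, ℓ, hℓp, hℓ1, ?_⟩
  rw [padicValNat_card_addPrimaryComponent] at hle
  exact hle

variable [W.IsGloballyMinimal]

/-- **Schneider's conjecture for every (B)-datum on X4♯(G-ord) ∩ `I₀*` ∩ {`ρ̄` onto} (`p ≥ 5`,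
`r_an = 1`) from the WEAK certificate** `BranchCoeffOneNeZeroAt W p` — gen 18's conjunct 2 of
`RankOneIwasawaInputAt` is DISCHARGED wherever the twisted branch has a simple zero.
[cite: Kato2004Asterisque, Thm. 17.4 (3) (p. 273)] [cite: Delbourgo2002, Theorem (B) (p. 40)] -/
theorem ClassX4Gord.schneider_of_katoHalf_of_ne_zero
    (hK : Wuthrich2014.kato_halfEigenCharIdeal_dvd_cyclotomicPrime_of_surjective)
    (hmodD : nonempty_modularParametrizationData)
    (hGZK : rank_eq_analyticRank_of_analyticRank_le_one)
    (hX : ClassX4Gord W p) (hp5 : 5 ≤ p) (he : semistabilityIndex W p = 2) (hsurj : Surj W p)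
    (hr : W.analyticRank = 1) (hne : BranchCoeffOneNeZeroAt W p)
    {Dh : PAdicHeightData W p} (hB : LeadingTermClauses W p Dh) : SchneiderConjecture Dh := by
  obtain ⟨V, iV, iVm, C, hV, hC⟩ := hX.exists_goodOrd_pStar_twist_model W p he
  haveI : NeZero (V.conductorNorm ℤ) := ⟨(V.conductorNorm_pos_holds).ne'⟩
  obtain ⟨Dm⟩ := hmodD V
  obtain ⟨ϖ, hϖ⟩ := exists_periodRatio_parity (p := p) V Dm
  have hord : IsOrdinaryAt V p :=
    isOrdinaryAt_of_goodOrd_or_mult_of_model_twist W V (pStar_ne_zero p) ⟨C, hC⟩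
      (padicValRat_j_nonneg_of_typeGOrd W p hX.typeGOrd) (Or.inl hV)
  exact (hX.schneider_and_padicVal_le_rankOne_of_katoHalf hK hGZK hp5 hsurj hr V C hC hV Dm.isNewformOf
    ϖ hϖ (hne V C hC hord Dm.f Dm.isNewformOf ϖ hϖ) hB).1

/-- **X3 twin**: Schneider for every (B)-datum on X3♯(G-ord) ∩ `I₀*` (odd `p`, `r_an = 1`), weak certificate. [cite: Wuthrich2014, Thm. 16 (p. 397)] -/
theorem ClassX3Gord.schneider_of_wuthrichHalf_of_ne_zero
    (hWu : Wuthrich2014.thm16_halfEigenCharIdeal_dvd_cyclotomicPrime)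
    (hmodD : nonempty_modularParametrizationData)
    (hGZK : rank_eq_analyticRank_of_analyticRank_le_one)
    (hX : ClassX3Gord W p) (hp2 : p ≠ 2) (he : semistabilityIndex W p = 2)
    (hr : W.analyticRank = 1) (hne : BranchCoeffOneNeZeroAt W p)
    {Dh : PAdicHeightData W p} (hB : LeadingTermClauses W p Dh) : SchneiderConjecture Dh := by
  obtain ⟨V, iV, iVm, C, hV, hC⟩ := hX.exists_goodOrd_pStar_twist_model W p hp2 he
  haveI : NeZero (V.conductorNorm ℤ) := ⟨(V.conductorNorm_pos_holds).ne'⟩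
  obtain ⟨Dm⟩ := hmodD V
  obtain ⟨ϖ, hϖ⟩ := exists_periodRatio_parity (p := p) V Dm
  have hord : IsOrdinaryAt V p :=
    isOrdinaryAt_of_goodOrd_or_mult_of_model_twist W V (pStar_ne_zero p) ⟨C, hC⟩
      (padicValRat_j_nonneg_of_typeGOrd W p hX.typeGOrd) (Or.inl hV)
  exact (hX.schneider_and_padicVal_le_rankOne_of_wuthrichHalf hWu hGZK hp2 hr V C hC hV
    Dm.isNewformOf ϖ hϖ (hne V C hC hord Dm.f Dm.isNewformOf ϖ hϖ) hB).1

/-- **On the weakly certified rows gen 18's residue predicate IS `BSD(E,p)`** (X4♯(G-ord) ∩ `I₀*` ∩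
{`ρ̄` onto}, `p ≥ 5`, non-CM, `r_an = 1`, non-anomalous). [cite: Delbourgo2002, Theorem (A), (B) (p. 40)]
[cite: Miller2011LMS, Def. 1.1] -/
theorem ClassX4Gord.rankOneIwasawaInputAt_iff_bsdp_of_katoHalf_of_ne_zero
    (hDel : Delbourgo2002.mainTheorem)
    (hK : Wuthrich2014.kato_halfEigenCharIdeal_dvd_cyclotomicPrime_of_surjective)
    (hmodD : nonempty_modularParametrizationData)
    (hGZK : rank_eq_analyticRank_of_analyticRank_le_one) (hmod : hasEntireLFunction_rat)
    (hX : ClassX4Gord W p) (hp5 : 5 ≤ p) (hcm : ¬ W.HasCM) (he : semistabilityIndex W p = 2)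
    (hsurj : Surj W p) (hr : W.analyticRank = 1) (hna : ReductionNonAnomalous W p)
    (hne : BranchCoeffOneNeZeroAt W p) :
    RankOneIwasawaInputAt W p ↔ BSDp W p := by
  have hadd : ¬ W.HasGoodReductionAtPrime p ∧ ¬ W.HasMultiplicativeReductionAtPrime p := hX.addv.2
  rw [rankOneIwasawaInputAt_iff_bsdp_and_exists_height W p hDel hGZK hmod hp5 hcm hX.addv.2 hX.typeGOrd
    hr hna]
  refine ⟨fun h ↦ h.1, fun h ↦ ⟨h, ?_⟩⟩
  obtain ⟨Dh, hB⟩ :=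
    Delbourgo2002.mainTheorem.exists_leadingTermClauses hDel hp5 hcm hadd hX.typeGOrd
  exact ⟨Dh, hB, hX.schneider_of_katoHalf_of_ne_zero hK hmodD hGZK hp5 he hsurj hr hne hB⟩

/-- **X3 twin** (X3♯(G-ord) ∩ `I₀*`, `p ≥ 5`, non-CM, `r_an = 1`, non-anomalous, weak certificate):
`RankOneIwasawaInputAt W p ↔ BSDp W p`. [cite: Delbourgo2002, Theorem (A), (B) (p. 40)] [cite: Miller2011LMS, Def. 1.1] -/
theorem ClassX3Gord.rankOneIwasawaInputAt_iff_bsdp_of_wuthrichHalf_of_ne_zero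
    (hDel : Delbourgo2002.mainTheorem)
    (hWu : Wuthrich2014.thm16_halfEigenCharIdeal_dvd_cyclotomicPrime)
    (hmodD : nonempty_modularParametrizationData)
    (hGZK : rank_eq_analyticRank_of_analyticRank_le_one) (hmod : hasEntireLFunction_rat)
    (hX : ClassX3Gord W p) (hp5 : 5 ≤ p) (hcm : ¬ W.HasCM) (he : semistabilityIndex W p = 2)
    (hr : W.analyticRank = 1) (hna : ReductionNonAnomalous W p)
    (hne : BranchCoeffOneNeZeroAt W p) :
    RankOneIwasawaInputAt W p ↔ BSDp W p := by
  have hadd : ¬ W.HasGoodReductionAtPrime p ∧ ¬ W.HasMultiplicativeReductionAtPrime p := hX.addv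
  rw [rankOneIwasawaInputAt_iff_bsdp_and_exists_height W p hDel hGZK hmod hp5 hcm hX.addv hX.typeGOrd
    hr hna]
  refine ⟨fun h ↦ h.1, fun h ↦ ⟨h, ?_⟩⟩
  obtain ⟨Dh, hB⟩ :=
    Delbourgo2002.mainTheorem.exists_leadingTermClauses hDel hp5 hcm hadd hX.typeGOrd
  exact ⟨Dh, hB, hX.schneider_of_wuthrichHalf_of_ne_zero hWu hmodD hGZK (by omega) he hr hne hB⟩

end Summit.BirchSwinnertonDyer.Rank1Residual.Additive

end
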